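import Summits.Parity.GeneralizedHardyLittlewood.Theorems.PrimeLevelFamEdgeIdeaDeltasFamilyDefs
import Literature.NumberTheory.LFunctions.HeckeLandauPageLowerBound
import Literature.NumberTheory.LFunctions.Zhang2022.TypedSection01and02A
import Literature.NumberTheory.LFunctions.LogDerivAtOneQuasiZeroFree
import Literature.Barriers.Parity.SiegelZeroDichotomyNoSiegelZeros
import HarnessLib

/-!
# Route `PrimeLevelFamEdge` — TYPED IDEA DELTAS, deck 14c: `negation` lens — K-L20-2 «THE SECOND PHANTOM»
# (cell ls-idea, seat ls-idea-lens-20 regen g0, card K-L20-2; the seat's `Sketch_L20b_SecondPhantom.lean`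
# sha16 e7d9d7317c4fa76f, critic E b5 PASS; LANDING NOTE typer ls-idea-typ-1 gen 3: VERBATIM up to
# (i) namespace `.L20b` → `.Negation`, (ii) the three 0-ary widening Props made PARAMETRIC in the depth
# constant `C` (`ConductorZFRWideningAt C`, `ComplexConductorZFRWideningAt C`, `RealConductorZFRWideningAt C`;
# the seat's (X3) ⟺ `∀ C > 0, ConductorZFRWideningAt C`), so every kernel item below is stated POINTWISE in
# `C` — a strengthening by logic only, (iii) imports moved above the module docstring.)

HONESTY: no exceptional-zero theorem (no Landau–Siegel / Siegel-zero exclusion, no Theorem 1–2 of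
arXiv:2211.02515, no repaired Margin232) is proved by ideation; no summit statement is proved by this
seat; typed ≠ proved; computed ≠ proved.  The KILL CLAIMS (`SaturationKillsKA C`,
`ComplexSaturationKillsKA C`) are DEFINED, never asserted: they are recipe-grade consequences of the
cell's (A)-world plateau law (BN-11, K5-8) transplanted from the exceptional character `χ_D` to an
arbitrary ZFR-saturating character `ψ`; everything under «KERNEL» is elementary logic / bookkeeping
proved here without `sorry`, pushing hypotheses through the tree's PROVED bridges
(`noSiegelZeros_of_not_unboundedSiegelZeros`, `Zhang2022.Section1.eq11Imp_holds`, `lOneLowerBound_mono`).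

## §0 What this sketch types (one paragraph)

K-L20-1 (gen 1) constructed the (A)-world model of record (pretentious table `x_D = μ²χ_D`) and met
three obstructions, the deciding one being (X0) «Page-exceptional characters recur» — summit-class.
K-L20-2 runs the SAME lens on a DIFFERENT model class: branch (ii) of K-I8-2, the NON-exceptional
characters `ψ` of polynomial conductor `r ≤ M^θ` (`M = q̂^{Δ′}`, `0 < θ < 1 − 1/Δ′`), COMPLEX INCLUDED.
The K5-8 one-swap/reflection mechanism (root number `ε(f ⊗ ψ̄) = ε_f ψ̄(q) τ(ψ̄)²/r`, alive iff
`M > r√q ⟺ θ < 1 − 1/Δ′`) gives each such `ψ` a level-DEPENDENT contribution to the second mollified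
moment of relative size `Λ_ψ · A(Δ′,P;θ) · Re(ω_ψ ψ(q) …)` with
`Λ_ψ ≈ M^{−2δ} (1 + κ δ log M)²` when `L(s,ψ)` has a zero at `1 − δ + iγ`, `|γ| ≲ 1` (residue form;
at `δ → 0` this is K5-8's amplitude `D⁰ = 1`).  With `δ = C / log r` and `r = M^θ`:
`Λ_ψ ≈ e^{−2C/θ}(1 + κC/θ)² > 0`, INDEPENDENT OF `M`.  Hence the PHANTOM WORLD

  ZSR(C): «infinitely many primitive `ψ_j` (conductor `r_j → ∞`, any order) with a zero of
          `L(s,ψ_j)` at depth `≤ C/log r_j`, height `≤ 1`»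

— permitted by every theorem once `C` exceeds the classical (de la Vallée Poussin–Gronwall–Landau)
constant, consistent with rh.S34 / `NoSiegelZeros`, with the route's leaf and with Page's theorem,
GRH-false and unexhibitable — makes the level-free beyond-diagonal asymptotics K_A FAIL at every
window `Δ′ > 1`, with NO exceptional character anywhere (recipe grade).  The typed OBSTRUCTION a
counterexample-builder meets is therefore not only (X0) but

  (X3) `∀ C > 0, ConductorZFRWideningAt C`: the zero-free constant tends to `∞` along conductors, for ALL primitive
       characters, at height `≤ 1` — which SPLITS (kernel: `conductorZFRWideningAt_iff`, pointwise in `C`) into a REAL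
       half (summit-class: it refutes `UnboundedSiegelZeros`, hence proves `NoSiegelZeros` and the
       leaf — kernel: `theorem1_of_conductorZFRWideningAt`) and a COMPLEX half
       `ComplexConductorZFRWideningAt C` that is SUMMIT-ORTHOGONAL: open for prime conductors (known only
       for `q^{o(1)}`-smooth conductors, Chang 2014 Thm 10 as quoted in Táfula arXiv:2001.02405 p. 8),
       implied by GRH (kernel: `conductorZFRWideningAt_of_GRH`), and untouched by ANY exceptional-zero
       theorem.

STRENGTH CERTIFICATE v2 (kernel, modulo the recipe-grade kill family): `SaturationKillsKA C ∧ K_A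
⊢ ConductorZFRWideningAt C` (`conductorZFRWideningAt_of_kA`, each `C`); complex half alone:
`ComplexSaturationKillsKA C ∧ K_A ⊢ ComplexConductorZFRWideningAt C`.  Reading for the door
ledger: a level-free K_A at prime level is NOT a pure ¬(A) door — a proof of `NoSiegelZeros` would not
discharge it; a proof of K_A would widen the 1899 zero-free region in the conductor aspect for every
Dirichlet character.  The new kill family CONTAINS gen-1's: `SaturationKillsKA C → AWorldKillsLevelFreeKA η₀`
for `η₀ ≥ 1/C` (`aWorldKills_of_saturationKills`), so gen-1's `pageKill` chain is a corollary.

Dictionary hook (tree, cited not restated): `Literature.NumberTheory.LFunctions.LogDerivAtOneQuasiZeroFree`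
(Táfula 2025): «depth of a zero-free box near 1 ↔ size of Re L′/L(1,χ)»; `¬ HasZeroNearOne C ψ` makes
Táfula's box `𝒬(r, log ·/C)` zero-free (`quasiZeroFree_of_not_hasZeroNearOne`), so under
`tafula2025_theorem_complex` the complex widening reads «Re L′/L(1,ψ) = o(log r) uniformly for complex
primitive ψ» — the `Λ_ψ → 0` reading of (X3) at `s = 1`.

Sources: BN-11 / K5-8 plateau law (cell record, PROVED closed form `plateauLaw_holds`); K-I8-2 branch
structure (cards/ls-idea-lens-8.md l.12); K5-1/K5-2/K5-3 (cards/ls-idea-lens-5.md l.10, l.26: generic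
resonance error `≤ C e^{−c′/(Δ′−1)}`, NOT `o(1)`); KMV 2000 p. 28 L71–77 («Δ beyond 1 … assuming GRH
[I-S]», cell record lens-16/18); Táfula arXiv:2001.02405 pp. 3, 8; McCurley 1984 p. 1 (classical
explicit region); TaoTeravainen2021 Def. 1.4 (`IsSiegelZero`).
-/

open Literature.NumberTheory.LFunctions
open Literature.NumberTheory.LFunctions.KMV2000
open Summit.Parity.GeneralizedHardyLittlewood.Theses.PrimeLevelFamEdge
open Summit.Parity.GeneralizedHardyLittlewood.Theorems.PrimeLevelFamEdgeIdeaDeltas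

namespace Summit.Parity.GeneralizedHardyLittlewood.Theorems.PrimeLevelFamEdgeIdeaDeltas.Negation

/-! ## §1 The phantom world: ZFR-saturating characters -/

/-- «`L(s,ψ)` has a zero at depth `≤ C/log r` below `1`, at height `≤ 1`»:
`∃ s, L(s,ψ) = 0 ∧ 1 − C/log r ≤ Re s < 1 ∧ |Im s| ≤ 1` (`ψ` a Dirichlet character mod `r`; for the
classical constant `C = c₀` and `ψ` complex this is exactly what de la Vallée Poussin–Landau forbid). -/
def HasZeroNearOne (C : ℝ) {r : ℕ} [NeZero r] (ψ : DirichletCharacter ℂ r) : Prop :=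
  ∃ s : ℂ, ψ.LFunction s = 0 ∧ 1 - C / Real.log r ≤ s.re ∧ s.re < 1 ∧ |s.im| ≤ 1

/-- THE PHANTOM WORLD ZSR(C) «ZFR-saturation recurs at constant `C`»: for arbitrarily large conductors
`r` some PRIMITIVE character mod `r` (any order — real or complex) has a zero at depth `≤ C/log r`,
height `≤ 1`.  Permitted by every known theorem for `C` above the classical constant (log-free
zero-density allows `O_C(1)` such zeros per modulus); GRH-false (`not_zfrSaturationRecurs_of_GRH`). -/
def ZFRSaturationRecurs (C : ℝ) : Prop :=
  ∀ r₀ : ℕ, ∃ (r : ℕ) (_ : NeZero r) (ψ : DirichletCharacter ℂ r),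
    r₀ ≤ r ∧ ψ.IsPrimitive ∧ HasZeroNearOne C ψ

/-- The COMPLEX phantom world: the same with `ψ² ≠ 1` (no real character, hence no exceptional zero,
anywhere in the construction). -/
def ComplexZFRSaturationRecurs (C : ℝ) : Prop :=
  ∀ r₀ : ℕ, ∃ (r : ℕ) (_ : NeZero r) (ψ : DirichletCharacter ℂ r),
    r₀ ≤ r ∧ ψ.IsPrimitive ∧ ψ ^ 2 ≠ 1 ∧ HasZeroNearOne C ψ

/-! ## §2 The typed obstructions -/

/-- OBSTRUCTION (X3) «CONDUCTOR-ASPECT ZERO-FREE WIDENING» AT DEPTH CONSTANT `C` (PARAMETRIC; the seat's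
0-ary (X3) is `∀ C > 0, ConductorZFRWideningAt C`): for all large conductors `r`, NO primitive character
mod `r` has a zero at depth `≤ C/log r`, height `≤ 1` — i.e. the de la Vallée Poussin–Landau constant
exceeds `C` along conductors, for ALL characters.  Real half summit-class, complex half summit-orthogonal
(see `conductorZFRWideningAt_iff`). -/
def ConductorZFRWideningAt (C : ℝ) : Prop :=
  ∃ r₀ : ℕ, ∀ (r : ℕ) [NeZero r] (ψ : DirichletCharacter ℂ r),
    r₀ ≤ r → ψ.IsPrimitive → ¬ HasZeroNearOne C ψ

/-- (X3ᶜ) the COMPLEX half of the widening at depth constant `C`: complex primitive characters only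
(`ψ² ≠ 1`).  For every `C`: known for `q^{o(1)}`-smooth conductors (Chang 2014, Thm 10, via Táfula
arXiv:2001.02405 p. 8), OPEN for prime conductors, implied by GRH, independent of every exceptional-zero
statement in the tree. -/
def ComplexConductorZFRWideningAt (C : ℝ) : Prop :=
  ∃ r₀ : ℕ, ∀ (r : ℕ) [NeZero r] (ψ : DirichletCharacter ℂ r),
    r₀ ≤ r → ψ.IsPrimitive → ψ ^ 2 ≠ 1 → ¬ HasZeroNearOne C ψ

/-- (X3ʳ) the REAL half of the widening at depth constant `C`: real primitive characters (`ψ² = 1`):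
«`(1 − β) log r > C` for every real zero `β` eventually, and no complex zeros of height `≤ 1` at depth
`≤ C/log r` either». -/
def RealConductorZFRWideningAt (C : ℝ) : Prop :=
  ∃ r₀ : ℕ, ∀ (r : ℕ) [NeZero r] (ψ : DirichletCharacter ℂ r),
    r₀ ≤ r → ψ.IsPrimitive → ψ ^ 2 = 1 → ¬ HasZeroNearOne C ψ

/-- KILL CLAIM (recipe grade; DEFINED, NOT ASSERTED): the phantom world ZSR(C) refutes the level-free
beyond-diagonal asymptotics K_A.  Mechanism: K5-8 reflection transplanted to `ψ`, amplitude
`Λ_ψ ≈ e^{−2C/θ}(1+κC/θ)² > 0` independent of `M` at every window `Δ′ > 1`, `0 < θ < 1 − 1/Δ′`. -/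
def SaturationKillsKA (C : ℝ) : Prop :=
  ZFRSaturationRecurs C → ¬ MomentsBeyondDiagonal

/-- KILL CLAIM, complex phantom only (recipe grade; DEFINED, NOT ASSERTED). -/
def ComplexSaturationKillsKA (C : ℝ) : Prop :=
  ComplexZFRSaturationRecurs C → ¬ MomentsBeyondDiagonal

/-! ## §3 KERNEL — logic and bookkeeping (no `sorry`) -/

/-- KERNEL: deeper boxes contain shallower ones (`log r ≥ 0` for a natural number `r`). -/
theorem HasZeroNearOne.mono {C C' : ℝ} (hCC' : C ≤ C') {r : ℕ} [NeZero r]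
    {ψ : DirichletCharacter ℂ r} (h : HasZeroNearOne C ψ) : HasZeroNearOne C' ψ := by
  obtain ⟨s, hs, hlo, hhi, him⟩ := h
  refine ⟨s, hs, ?_, hhi, him⟩
  have : C / Real.log r ≤ C' / Real.log r :=
    div_le_div_of_nonneg_right hCC' (Real.log_natCast_nonneg r)
  linarith

/-- KERNEL: the phantom world at `C` persists at every larger constant. -/
theorem ZFRSaturationRecurs.mono {C C' : ℝ} (hCC' : C ≤ C') (h : ZFRSaturationRecurs C) :
    ZFRSaturationRecurs C' := by
  intro r₀
  obtain ⟨r, _, ψ, hr, hprim, hz⟩ := h r₀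
  exact ⟨r, ‹NeZero r›, ψ, hr, hprim, hz.mono hCC'⟩

/-- KERNEL: the complex phantom world is a phantom world. -/
theorem ComplexZFRSaturationRecurs.toZFRSaturationRecurs {C : ℝ} (h : ComplexZFRSaturationRecurs C) :
    ZFRSaturationRecurs C := by
  intro r₀
  obtain ⟨r, _, ψ, hr, hprim, _, hz⟩ := h r₀
  exact ⟨r, ‹NeZero r›, ψ, hr, hprim, hz⟩

/-- KERNEL (bookkeeping between the two kill families): by logic alone neither of
`SaturationKillsKA C`, `ComplexSaturationKillsKA C` implies the other (their antecedents are not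
comparable world by world); what holds is the CASE SPLIT — a kill of the complex phantom together with
a kill of the real phantom (the latter is gen-1's Page-scale territory at quality `1/C`) is a kill of
the full phantom world ZSR(C). -/
theorem saturationKillsKA_of_complex_and_real {C : ℝ}
    (hc : ComplexSaturationKillsKA C)
    (hr : (∀ r₀ : ℕ, ∃ (r : ℕ) (_ : NeZero r) (ψ : DirichletCharacter ℂ r),
        r₀ ≤ r ∧ ψ.IsPrimitive ∧ ψ ^ 2 = 1 ∧ HasZeroNearOne C ψ) → ¬ MomentsBeyondDiagonal) :
    SaturationKillsKA C := by
  intro hsat hA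
  -- either complex saturation recurs, or from some point on every saturating character is real
  by_cases hcx : ComplexZFRSaturationRecurs C
  · exact hc hcx hA
  · apply hr _ hA
    intro r₀
    -- `hcx : ¬ ∀ r₁, ∃ complex saturating ψ beyond r₁`: get `r₁` beyond which saturating ψ are real
    simp only [ComplexZFRSaturationRecurs, not_forall, not_exists, not_and] at hcx
    obtain ⟨r₁, hr₁⟩ := hcx
    obtain ⟨r, _, ψ, hr, hprim, hz⟩ := hsat (max r₀ r₁)
    refine ⟨r, ‹NeZero r›, ψ, le_trans (le_max_left _ _) hr, hprim, ?_, hz⟩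
    by_contra hsq
    exact hr₁ r ‹NeZero r› ψ (le_trans (le_max_right _ _) hr) hprim hsq hz

/-- KERNEL: the widening SPLITS into its real and complex halves (at each depth constant `C`). -/
theorem conductorZFRWideningAt_iff (C : ℝ) :
    ConductorZFRWideningAt C ↔ RealConductorZFRWideningAt C ∧ ComplexConductorZFRWideningAt C := by
  constructor
  · intro h
    exact ⟨h.imp fun r₀ hr₀ r _ ψ hr hprim _ ↦ hr₀ r ψ hr hprim,
      h.imp fun r₀ hr₀ r _ ψ hr hprim _ ↦ hr₀ r ψ hr hprim⟩
  · rintro ⟨⟨r₁, hr₁⟩, ⟨r₂, hr₂⟩⟩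
    refine ⟨max r₁ r₂, fun r _ ψ hr hprim ↦ ?_⟩
    by_cases hsq : ψ ^ 2 = 1
    · exact hr₁ r ψ (le_trans (le_max_left _ _) hr) hprim hsq
    · exact hr₂ r ψ (le_trans (le_max_right _ _) hr) hprim hsq

/-- KERNEL: «not widening at `C`» is «saturation recurs at constant `C`» (classical logic); hence the
seat's «¬ (X3) ⟺ ∃ C > 0, ZSR(C)». -/
theorem not_conductorZFRWideningAt_iff (C : ℝ) :
    ¬ ConductorZFRWideningAt C ↔ ZFRSaturationRecurs C := by
  constructor
  · intro h r₀
    by_contra hx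
    apply h
    exact ⟨r₀, fun r _ ψ hr₀ hprim hz ↦ hx ⟨r, ‹NeZero r›, ψ, hr₀, hprim, hz⟩⟩
  · rintro hsat ⟨r₀, hr₀⟩
    obtain ⟨r, _, ψ, hr, hprim, hz⟩ := hsat r₀
    exact hr₀ r ψ hr hprim hz

/-- KERNEL: the seat's form «¬ (X3) ⟺ saturation recurs at SOME constant `C > 0`». -/
theorem not_forall_conductorZFRWideningAt_iff :
    (¬ ∀ C : ℝ, 0 < C → ConductorZFRWideningAt C) ↔ ∃ C : ℝ, 0 < C ∧ ZFRSaturationRecurs C := by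
  simp only [not_forall, not_conductorZFRWideningAt_iff, exists_prop]

/-- KERNEL: «no complex widening at `C`» is «the complex phantom recurs at `C`». -/
theorem not_complexConductorZFRWideningAt_iff (C : ℝ) :
    ¬ ComplexConductorZFRWideningAt C ↔ ComplexZFRSaturationRecurs C := by
  constructor
  · intro h r₀
    by_contra hx
    apply h
    exact ⟨r₀, fun r _ ψ hr₀ hprim hsq hz ↦ hx ⟨r, ‹NeZero r›, ψ, hr₀, hprim, hsq, hz⟩⟩
  · rintro hsat ⟨r₀, hr₀⟩
    obtain ⟨r, _, ψ, hr, hprim, hsq, hz⟩ := hsat r₀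
    exact hr₀ r ψ hr hprim hsq hz

/-- KERNEL: a Siegel zero of quality `η ≥ 1/C` (tree sense, `q ≥ 2`) IS a zero at depth `≤ C/log q`,
height `0`: the exceptional character is the real, `C → 0` end of the phantom family. -/
theorem hasZeroNearOne_of_isSiegelZero {q : ℕ} [NeZero q] {χ : DirichletCharacter ℂ q} {η C : ℝ}
    (hC : 0 < C) (hq : 2 ≤ q) (hηC : 1 / C ≤ η)
    (hS : Literature.Barriers.Parity.IsSiegelZero χ η) : HasZeroNearOne C χ := by
  obtain ⟨_, _, h10, hzero⟩ := hS
  have hq2 : (2 : ℝ) ≤ q := by exact_mod_cast hq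
  have hlog : 0 < Real.log q := Real.log_pos (by linarith)
  have hηpos : 0 < η := by linarith
  have h1 : 1 / η ≤ C := (one_div_le hηpos hC).mpr hηC
  have h2 : 1 / (η * Real.log q) ≤ C / Real.log q := by
    rw [← div_div]
    exact div_le_div_of_nonneg_right h1 hlog.le
  have h3 : 0 < 1 / (η * Real.log q) := by positivity
  refine ⟨((1 - 1 / (η * Real.log q) : ℝ) : ℂ), hzero, ?_, ?_, ?_⟩
  · simp only [Complex.ofReal_re]; linarith
  · simp only [Complex.ofReal_re]; linarith
  · simp only [Complex.ofReal_im, abs_zero]; norm_num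

/-- KERNEL: the old phantom family sits inside the new one at EVERY constant:
`UnboundedSiegelZeros → ZSR(C)` for all `C > 0`. -/
theorem zfrSaturationRecurs_of_unboundedSiegelZeros
    (hU : Literature.Barriers.Parity.UnboundedSiegelZeros) {C : ℝ} (hC : 0 < C) :
    ZFRSaturationRecurs C := by
  intro r₀
  obtain ⟨q, _, χ, η, hq, hη, hS⟩ := hU (max 10 (1 / C)) (max r₀ 2)
  exact ⟨q, ‹NeZero q›, χ, le_trans (le_max_left _ _) hq, hS.1,
    hasZeroNearOne_of_isSiegelZero hC (le_trans (le_max_right _ _) hq)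
      (le_trans (le_max_right _ _) hη) hS⟩

/-- KERNEL: the widening at any POSITIVE depth constant refutes `UnboundedSiegelZeros` … -/
theorem not_unboundedSiegelZeros_of_conductorZFRWideningAt {C : ℝ} (hC : 0 < C)
    (hW : ConductorZFRWideningAt C) : ¬ Literature.Barriers.Parity.UnboundedSiegelZeros := fun hU ↦
  (not_conductorZFRWideningAt_iff C).mpr (zfrSaturationRecurs_of_unboundedSiegelZeros hU hC) hW

/-- … and so does its REAL half alone (Siegel-zero characters are quadratic, `χ² = 1`). -/
theorem not_unboundedSiegelZeros_of_realWideningAt {C : ℝ} (hC : 0 < C)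
    (hW : RealConductorZFRWideningAt C) : ¬ Literature.Barriers.Parity.UnboundedSiegelZeros := by
  intro hU
  obtain ⟨r₀, hr₀⟩ := hW
  obtain ⟨q, _, χ, η, hq, hη, hS⟩ := hU (max 10 (1 / C)) (max r₀ 2)
  exact hr₀ q χ (le_trans (le_max_left _ _) hq) hS.1 hS.2.1.sq_eq_one
    (hasZeroNearOne_of_isSiegelZero hC (le_trans (le_max_right _ _) hq)
      (le_trans (le_max_right _ _) hη) hS)

/-- KERNEL: hence the widening (indeed its real half, at any one constant `C > 0`) proves
`NoSiegelZeros` (rh.S34) through the tree's PROVED bridge `noSiegelZeros_of_not_unboundedSiegelZeros` … -/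
theorem noSiegelZeros_of_realWideningAt {C : ℝ} (hC : 0 < C) (hW : RealConductorZFRWideningAt C) :
    NoSiegelZeros :=
  Literature.Barriers.Parity.noSiegelZeros_of_not_unboundedSiegelZeros
    (not_unboundedSiegelZeros_of_realWideningAt hC hW)

/-- KERNEL: the full widening at one constant `C > 0` proves `NoSiegelZeros`. -/
theorem noSiegelZeros_of_conductorZFRWideningAt {C : ℝ} (hC : 0 < C) (hW : ConductorZFRWideningAt C) :
    NoSiegelZeros :=
  noSiegelZeros_of_realWideningAt hC ((conductorZFRWideningAt_iff C).mp hW).1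

/-- KERNEL: … and the route's LEAF `Theorem1 = LOneLowerBound 2022` (via `eq11Imp_holds`,
`lOneLowerBound_mono`): the REAL half of obstruction (X3) is summit-class — already at ONE constant. -/
theorem theorem1_of_realWideningAt {C : ℝ} (hC : 0 < C) (hW : RealConductorZFRWideningAt C) :
    Zhang2022.Skeleton.Theorem1 :=
  Zhang2022.Section1.lOneLowerBound_mono (by norm_num)
    (Zhang2022.Section1.eq11Imp_holds (noSiegelZeros_of_realWideningAt hC hW))

/-- KERNEL: the full widening at one constant `C > 0` proves the route's leaf `Theorem1`. -/
theorem theorem1_of_conductorZFRWideningAt {C : ℝ} (hC : 0 < C) (hW : ConductorZFRWideningAt C) :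
    Zhang2022.Skeleton.Theorem1 :=
  theorem1_of_realWideningAt hC ((conductorZFRWideningAt_iff C).mp hW).1

/-- KERNEL — STRENGTH CERTIFICATE v2 (pointwise in the constant): if the saturation kill holds at
constant `C` (recipe grade), then K_A proves the conductor-aspect widening at `C` for ALL primitive
characters; the seat's form «(∀ C > 0, kill) ∧ K_A ⊢ (X3)» is the `∀ C` of this. -/
theorem conductorZFRWideningAt_of_kA {C : ℝ} (hK : SaturationKillsKA C)
    (hA : MomentsBeyondDiagonal) : ConductorZFRWideningAt C := by
  by_contra hW
  exact hK ((not_conductorZFRWideningAt_iff C).mp hW) hA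

/-- KERNEL — the SUMMIT-ORTHOGONAL half of the certificate: if the complex-phantom kill holds at
constant `C`, K_A proves the complex conductor-aspect widening at `C` (GRH-implied, Siegel-independent). -/
theorem complexConductorZFRWideningAt_of_kA {C : ℝ} (hK : ComplexSaturationKillsKA C)
    (hA : MomentsBeyondDiagonal) : ComplexConductorZFRWideningAt C := by
  by_contra hW
  exact hK ((not_complexConductorZFRWideningAt_iff C).mp hW) hA

/-- KERNEL: hence (modulo the kill at one constant `C > 0`) `K_A ⊢ Theorem1` — the leaf — AND
`K_A ⊢ (X3ᶜ)` at `C`. -/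
theorem theorem1_and_complexWidening_of_kA {C : ℝ} (hC : 0 < C) (hK : SaturationKillsKA C)
    (hA : MomentsBeyondDiagonal) :
    Zhang2022.Skeleton.Theorem1 ∧ ComplexConductorZFRWideningAt C :=
  ⟨theorem1_of_conductorZFRWideningAt hC (conductorZFRWideningAt_of_kA hK hA),
    ((conductorZFRWideningAt_iff C).mp (conductorZFRWideningAt_of_kA hK hA)).2⟩

/-- KERNEL: the new kill family CONTAINS gen-1's Page-scale kill family: a saturation kill at
constant `C` is an (A)-world kill at every quality `η₀ ≥ 1/C` (`AWorldKillsLevelFreeKA`, FamilyDefs). -/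
theorem aWorldKills_of_saturationKills {C η₀ : ℝ} (hC : 0 < C) (hη : 1 / C ≤ η₀)
    (h : SaturationKillsKA C) : AWorldKillsLevelFreeKA η₀ := by
  intro hant hA
  refine h (fun r₀ ↦ ?_) hA
  obtain ⟨q, _, χ, η, hq, hηη, hS⟩ := hant (max r₀ 2)
  exact ⟨q, ‹NeZero q›, χ, le_trans (le_max_left _ _) hq, hS.1,
    hasZeroNearOne_of_isSiegelZero hC (le_trans (le_max_right _ _) hq) (le_trans hη hηη) hS⟩

/-- KERNEL: the phantom world is GRH-false / the widening is GRH-implied at every constant (so (X3ᶜ) is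
a consequence of GRH that no exceptional-zero theorem touches). -/
theorem conductorZFRWideningAt_of_GRH (h : GeneralizedRiemannHypothesis) {C : ℝ} (hC : 0 < C) :
    ConductorZFRWideningAt C := by
  refine ⟨⌈Real.exp (2 * C)⌉₊ + 1, fun r _ ψ hr _ hz ↦ ?_⟩
  obtain ⟨s, hs0, hlo, hhi, _⟩ := hz
  have hr' : Real.exp (2 * C) < r := by
    have h1 : Real.exp (2 * C) ≤ ⌈Real.exp (2 * C)⌉₊ := Nat.le_ceil _
    have h2 : ((⌈Real.exp (2 * C)⌉₊ + 1 : ℕ) : ℝ) ≤ r := by exact_mod_cast hr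
    push_cast at h2
    linarith
  have hlog : 2 * C < Real.log r := by
    have := Real.log_lt_log (Real.exp_pos _) hr'
    rwa [Real.log_exp] at this
  have hlogpos : 0 < Real.log r := by linarith
  have hCl : C / Real.log r < 1 / 2 := by
    rw [div_lt_iff₀ hlogpos]; linarith
  have hre : s.re = 1 / 2 := h r ψ s hs0 (by linarith) hhi
  linarith

/-- KERNEL: GRH kills the phantom world at every constant `C > 0`. -/
theorem not_zfrSaturationRecurs_of_GRH (h : GeneralizedRiemannHypothesis) {C : ℝ} (hC : 0 < C) :
    ¬ ZFRSaturationRecurs C := fun hsat ↦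
  (not_conductorZFRWideningAt_iff C).mpr hsat (conductorZFRWideningAt_of_GRH h hC)

/-- KERNEL — dictionary hook (Táfula 2025, tree file `LogDerivAtOneQuasiZeroFree`): «no zero at depth
`≤ C/log r`, height `≤ 1`» makes Táfula's box `𝒬(r, f)` with `f = log · / C` zero-free, hence quasi
zero-free; so under the NAMED FACT `tafula2025_theorem_complex` the complex widening is the statement
«`Re L′/L(1,ψ) = O(log r/√C)` for every `C`», i.e. `o(log r)` — the `Λ_ψ → 0` reading at `s = 1`. -/
theorem quasiZeroFree_of_not_hasZeroNearOne {r : ℕ} [NeZero r] {C : ℝ}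
    {ψ : DirichletCharacter ℂ r} (hψ : ψ ≠ 1) (h : ¬ HasZeroNearOne C ψ) :
    Tafula2025.QuasiZeroFree (fun q ↦ Real.log q / C) ψ := by
  apply Tafula2025.quasiZeroFree_of_forall_ne_zero
  intro s hs hzero
  apply h
  simp only [Tafula2025.box, Set.mem_setOf_eq, one_div_div] at hs
  refine ⟨s, hzero, hs.1.le, ?_, ?_⟩
  · by_contra hre
    rw [not_lt] at hre
    exact DirichletCharacter.LFunction_ne_zero_of_one_le_re ψ (Or.inl hψ) hre hzero
  · have : 0 ≤ 1 / Real.sqrt (Real.log r / C * Real.log r) := by positivity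
    linarith [hs.2]

/-! ## §4 KERNEL — the phantom bites at every window (arithmetic of the reflection condition) -/

/-- The K5-8 reflection term for a character of conductor `r = M^θ` is alive iff `M > r √q`, i.e.
`θ < 1 − 1/Δ′` (`M = q̂^{Δ′}`): every window `Δ′ > 1` admits such `θ > 0`. -/
theorem exists_reflectionExponent {Δ' : ℝ} (hΔ : 1 < Δ') : ∃ θ : ℝ, 0 < θ ∧ θ < 1 - 1 / Δ' := by
  have h1 : 1 / Δ' < 1 := by rw [div_lt_iff₀ (by linarith)]; linarith
  exact ⟨(1 - 1 / Δ') / 2, by linarith, by linarith⟩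

/-- The saturation amplitude profile `Λ(u) = (1 + κu)² e^{−2u}` (`u = C/θ = δ log M`) is POSITIVE for
every `u` — the level-dependent term has a FIXED relative size at fixed depth-constant `C`, which is why
weakening the RATE of K_A (`1/log` → `o(1)`) does not shed obstruction (X3). -/
theorem amp_pos (κ u : ℝ) (hκ : 0 ≤ κ) (hu : 0 ≤ u) : 0 < (1 + κ * u) ^ 2 * Real.exp (-2 * u) := by
  have : 0 < 1 + κ * u := by positivity
  positivity

end Summit.Parity.GeneralizedHardyLittlewood.Theorems.PrimeLevelFamEdgeIdeaDeltas.Negation
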